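import Summits.BirchSwinnertonDyer.BirchSwinnertonDyer.Theorems.KimAtThreeDeepUpperExpStarFactsCanonical
import Summits.BirchSwinnertonDyer.BirchSwinnertonDyer.Theorems.KimAtThreeDeepLowerExpStarOmegaRes
import Literature.NumberTheory.PAdicHodge.DualExpEllipticTower
import HarnessLib

/-!
# (S5b-tower) INSTANTIATED in class currency: ONE rescaling `e ∈ ℚ_vˣ` normalising `exp*_ω` at `ℚ_v` (read in
# `ℚ_p`) AND at a factor field `L ⊇ ℚ_v` (route `KimAtThreeKolyvagin`, rung W2, cruxes 19076 / 19560; cell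
# `bsd-addord`, seat w2-c3 gen 8)

HONEST FRAMING. Theorems only (local instances on `ℚ_v` exactly as in `KimAtThreeDeepUpperExpStarFacts`); nothing
is closed or booked; BSD is not proved by any of this. CONDITIONAL on the cite fact (S5b-tower)
`PAdicHodge.exists_smul_range_expStarCoord_tower_iff_trace_log` (`Literature/NumberTheory/PAdicHodge/DualExpEllipticTower.lean`,
p511026; Kato II Thm. 1.4.1 (3)–(4) + BK90 Prop. 3.8 / Ex. 3.11 at two levels of a tower for ONE differential).

WANTED by w2-acc4 g5 (STATUS 2026-08-27T08:03:36Z, split item (1), for hLog₀ of crux 19560) and by this seat's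
discharge of w2-c2 g9's hLatᵘ (per-factor lattice bound of item 20013, `KimAtThreeDeepLowerKatoParts`): the fact
(S5b-tower) is typed in Literature currency (crossed homomorphisms of `restrictedTateRep`, `expStarCoord` /
`expStarCoordTower`, traces to `ℚ_p`, `padicLogPointFiniteExt`); the consumers speak CLASSES
(`(tateLocalRep W p (inr v)).cohomology 1`, w2-c2's `expStarOmegaPadicAt` / `expStarOmegaHom`, the Summits
logarithm `padicLog` on `E(ℚ_p)`). This file does the reading, for a GENERIC `p`-adic field `L ⊇ ℚ_v` (all structures
as instance ARGUMENTS, so kim3's `letI` block at `L_w = w.1.adicCompletion (ℚ(ζ_m))` instantiates it by unification):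

* `expStarOmegaHom_comp_oneCocycleClass` — on the tower representation
  `localTateRep W p ((galRestrictPlace v).comp (absGaloisRestrict ℚ_v L))` (DEFINITIONALLY
  `(restrictedTateRep W ℚ_v p).restrict (absGaloisRestrict ℚ_v L)`, `localTateRep_comp`),
  `expStarOmegaHom hL _ dw hinjw hexw [η] = expStarCoordTower W hL dw η` (`rfl` after `expStarOmega_oneCocycleClass`);
* `exists_smul_ranges_of_facts` — **for a local Néron line `d` at `v ∋ p`, a line datum `dw` at `L` with
  (RES_w) `exp*_{dw} ∘ res = (ℚ_v → L) ∘ exp*_d` on classes (w2-c2's (RES) theorem produces such `dw`), there is ONE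
  `e ∈ ℚ_vˣ` with `hdual` VERBATIM for `expStarOmegaPadicAt (d.smul e he) hinj hex ι` (every `ι : ℚ_v →+* ℚ_p`,
  rigidity `ringHom_place_padic_ext`) AND `range(expStarOmegaHom … (dw.smul (algebraMap e) _) hinjw hexw) =
  {a : ∀ P′ ∈ E(L), ‖Tr_{L/ℚ_p}(a · log_ω P′)‖ ≤ 1}`** for every compatible `ν` on `L` making `W ⊗ L` integral
  (kport's `isIntegral_baseChange_of_isGloballyMinimal` frees that binder at `L_w`; `trace_adicCompletionPadicAlgebra_eq`
  turns `Tr_{L_w/ℚ_p}` into `e_p⁻¹ ∘ Tr_{L_w/ℚ_v}`). Proof: (S5b-tower) at `F₀ = ℚ_v` with the valuation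
  `‖padicEquiv ·‖` (`compatible_of_norm_algEquiv`, `isIntegral_baseChange_of_norm_algEquiv`), `F = L`, `d₀ := d`,
  `d := dw`; the cocycle-level compatibility from (RES_w) by `cohomologyRes_oneCocycleClass`; the base conjunct read in
  `ℚ_p` exactly as `hdual_of_facts` (`trace_eq`, `padicLog_eq_padicLogPointFiniteExt`,
  `padicLogPointFiniteExt_map_algEquiv`, `exists_map_algEquiv_eq`).

References: [Kato1993LNM1553] Ch. II §1.2.4, Thm. 1.4.1 (3)–(4), Lemma 1.4.3–1.4.5; [BlochKato1990] §3 Prop. 3.8,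
Ex. 3.11; [SerreLocalFields1979] Ch. II §5 (rigidity of `ℚ_p`); [SilvermanAEC2009] IV.6.4, VII.2.2.
-/

set_option autoImplicit false
-- the Theorems namespace of a single-conjunct summit repeats the summit name by design (D-0017)
set_option linter.dupNamespace false

noncomputable section

open scoped NumberField NNReal Classical
open Field ValuativeRel IsDedekindDomain NumberField
open Literature.NumberTheory.GaloisRepresentations
open Literature.NumberTheory.GaloisRepresentations.PeriodRingData
open Literature.NumberTheory.PAdicHodge
open Literature.NumberTheory.EllipticCurves WeierstrassCurve
open Literature.NumberTheory.EllipticCurves.FormalGroupChart (padicLogPointFiniteExt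
  isIntegral_valuationInteger_of_isIntegral_padicInt)
open Summit.BirchSwinnertonDyer.BirchSwinnertonDyer.Theorems.KimAtThreeDeepLowerExpStarOmega
open Summit.BirchSwinnertonDyer.BirchSwinnertonDyer.Theorems.KimAtThreeDeepLowerExpStarOmegaPlace
open Summit.BirchSwinnertonDyer.BirchSwinnertonDyer.Theorems.KimAtThreeDeepLowerExpStarOmegaRes
open Summit.BirchSwinnertonDyer.BirchSwinnertonDyer.Theorems.KimAtThreeDeepUpperExpStarTransport
open Summit.BirchSwinnertonDyer.BirchSwinnertonDyer.Theorems.KimAtThreeDeepUpperExpStarFacts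
open Summit.BirchSwinnertonDyer.BirchSwinnertonDyer.Theorems.KimAtThreeDeepUpperExpStarFactsCanonical
open Summit.BirchSwinnertonDyer.Rank1Residual.GaloisImage
open Summit.BirchSwinnertonDyer.Rank1Residual.Additive (LocalLog.padicLog)
open Rat.HeightOneSpectrum

namespace Summit.BirchSwinnertonDyer.BirchSwinnertonDyer.Theorems.KimAtThreeDeepUpperExpStarTowerRange

variable (W : WeierstrassCurve ℚ) [W.IsElliptic] (p : ℕ) [Fact p.Prime]
  (v : HeightOneSpectrum (𝓞 ℚ)) [hv : Fact (((p : ℕ) : 𝓞 ℚ) ∈ v.asIdeal)]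

-- the tree's `ℚ`-algebra structure on `ℚ_v` first (see `KimAtThreeDeepUpperExpStarFacts`)
attribute [local instance 100000] NumberField.Place.instAlgebraCompletion
attribute [local instance] valuativeRelPlace topologicalSpacePlace
attribute [local instance] isNonarchimedeanLocalField_place charZero_place
attribute [local instance] padicAlgebraPlace fact_not_isUnit_place isAdicComplete_place

variable {L : Type} [Field L] [ValuativeRel L] [TopologicalSpace L] [IsNonarchimedeanLocalField L]
  [CharZero L] [Algebra ℚ L] [Algebra (Place.Completion (Sum.inr v : Place ℚ)) L]
  [Fact (¬ IsUnit (p : integerC L))] [IsAdicComplete (Ideal.span {(p : integerC L)}) (integerC L)]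
  (hL : valuation L p < 1) [Algebra ℚ_[p] L]

omit hv [Algebra ℚ L] in
/-- **`exp*_ω` on the class of a crossed homomorphism `η` of the TOWER representation is the Literature
`expStarCoordTower` of `η`** (definitional: `localTateRep_comp`, `expStarOmega_oneCocycleClass`).
[cite: Kato1993LNM1553, Ch. II §1.2.4] -/
theorem expStarOmegaHom_comp_oneCocycleClass
    (dw : LocalNeronLine W hL ((galRestrictPlace v).comp
      (absGaloisRestrict (Place.Completion (Sum.inr v : Place ℚ)) L)))
    (hinjw : (bdRPeriodRingData (F := L) (p := p) hL).CupLogInjective (logCyclotomic p)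
      (localRationalTateRep W p
        ((galRestrictPlace v).comp (absGaloisRestrict (Place.Completion (Sum.inr v : Place ℚ)) L))))
    (hexw : ∀ z : contOneCocycles (localRationalTateRep W p
        ((galRestrictPlace v).comp (absGaloisRestrict (Place.Completion (Sum.inr v : Place ℚ)) L))).toTopRep,
      (bdRPeriodRingData (F := L) (p := p) hL).HasDualExp (logCyclotomic p)
        (localRationalTateRep W p
          ((galRestrictPlace v).comp (absGaloisRestrict (Place.Completion (Sum.inr v : Place ℚ)) L)))
        fun σ => z.1 σ)
    (η : contOneCocycles (localTateRep W p ((galRestrictPlace v).comp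
      (absGaloisRestrict (Place.Completion (Sum.inr v : Place ℚ)) L))).toTopRep) :
    expStarOmegaHom hL _ dw hinjw hexw (oneCocycleClass _ η) =
      expStarCoordTower W (F₀ := Place.Completion (Sum.inr v : Place ℚ)) hL dw η := by
  rw [expStarOmegaHom_apply, expStarOmega_oneCocycleClass]
  rfl

/-- **(S5b-tower) instantiated, CLASS currency.** For a local Néron line `d` at `v ∋ p` (Prop-1.2.3 binders
`hinj`/`hex`), a factor field `L ⊇ ℚ_v` with a line datum `dw` of the tower representation (binders `hinjw`/`hexw`)
compatible under restriction — (RES_w) `exp*_{dw}(res h) = (ℚ_v → L)(exp*_d h)` — there is ONE `e ∈ ℚ_vˣ` with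
`range(ι ∘ exp*_{e•d}) = {a : ∀ Q ∈ E(ℚ_p), ‖a · log_ω Q‖ ≤ 1}` (for EVERY `ι : ℚ_v →+* ℚ_p`) AND
`range(exp*_{e•dw}) = {a : ∀ P′ ∈ E(L), ‖Tr_{L/ℚ_p}(a · log_ω P′)‖ ≤ 1}` (for every compatible `ν` on `L` making
the model integral). From `PAdicHodge.exists_smul_range_expStarCoord_tower_iff_trace_log` at `F₀ = ℚ_v`
(valuation `‖padicEquiv ·‖`), `F = L`; the base conjunct is read in `ℚ_p` as in `hdual_of_facts`.
[cite: Kato1993LNM1553, Ch. II Thm. 1.4.1 (3)–(4), Lemma 1.4.3–1.4.5 and §1.2.4] [cite: BlochKato1990, Prop. 3.8 (p. 354), Example 3.11 (p. 361)] -/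
theorem exists_smul_ranges_of_facts [W.IsGloballyMinimal]
    (hT₂ : exists_smul_range_expStarCoord_tower_iff_trace_log)
    (d : LocalNeronLineAt W p v)
    (hinj : (bdRPeriodRingData (valuation_place_lt_one p v)).CupLogInjective (logCyclotomic p)
      (localRationalTateRep W p (galRestrictPlace v)))
    (hex : ∀ z : contOneCocycles (localRationalTateRep W p (galRestrictPlace v)).toTopRep,
      (bdRPeriodRingData (valuation_place_lt_one p v)).HasDualExp (logCyclotomic p)
        (localRationalTateRep W p (galRestrictPlace v)) fun σ => z.1 σ)
    (ν : Valuation L ℝ≥0) [ν.Compatible] [(W.baseChange L).IsIntegral ν.integer]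
    (dw : LocalNeronLine W hL ((galRestrictPlace v).comp
      (absGaloisRestrict (Place.Completion (Sum.inr v : Place ℚ)) L)))
    (hinjw : (bdRPeriodRingData (F := L) (p := p) hL).CupLogInjective (logCyclotomic p)
      (localRationalTateRep W p
        ((galRestrictPlace v).comp (absGaloisRestrict (Place.Completion (Sum.inr v : Place ℚ)) L))))
    (hexw : ∀ z : contOneCocycles (localRationalTateRep W p
        ((galRestrictPlace v).comp (absGaloisRestrict (Place.Completion (Sum.inr v : Place ℚ)) L))).toTopRep,
      (bdRPeriodRingData (F := L) (p := p) hL).HasDualExp (logCyclotomic p)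
        (localRationalTateRep W p
          ((galRestrictPlace v).comp (absGaloisRestrict (Place.Completion (Sum.inr v : Place ℚ)) L)))
        fun σ => z.1 σ)
    (hres : ∀ h : (tateLocalRep W p (Sum.inr v)).cohomology 1,
      expStarOmegaHom hL _ dw hinjw hexw
          ((tateLocalRep W p (Sum.inr v)).cohomologyRes
            (absGaloisRestrict (Place.Completion (Sum.inr v : Place ℚ)) L) 1 h) =
        algebraMap (Place.Completion (Sum.inr v : Place ℚ)) L (expStarOmegaAt d h))
    (ι : Place.Completion (Sum.inr v : Place ℚ) →+* ℚ_[p]) :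
    ∃ (e : Place.Completion (Sum.inr v : Place ℚ)) (he : e ≠ 0),
      (∀ a : ℚ_[p], (∃ y, expStarOmegaPadicAt (d.smul e he) hinj hex ι y = a) ↔
        ∀ Q : (W.baseChange ℚ_[p]).toAffine.Point, ‖a * LocalLog.padicLog (W.baseChange ℚ_[p]) Q‖ ≤ 1) ∧
      (∀ a : L,
        (∃ y, expStarOmegaHom hL _ (dw.smul (algebraMap (Place.Completion (Sum.inr v : Place ℚ)) L e)
            ((map_ne_zero (algebraMap (Place.Completion (Sum.inr v : Place ℚ)) L)).mpr he)) hinjw hexw y = a) ↔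
        ∀ P' : (W.baseChange L).toAffine.Point,
          ‖Algebra.trace ℚ_[p] L (a * padicLogPointFiniteExt ν (W.baseChange L) p P')‖ ≤ 1) := by
  have hpv : ((p : ℕ) : 𝓞 ℚ) ∈ v.asIdeal := hv.out
  have hp' := primesEquiv_eq p v hpv
  subst hp'
  -- the isomorphism `ℚ_v ≃ ℚ_p` and the transported `p`-adic norm (as in `hdual_of_facts`)
  let eA0 : v.adicCompletion ℚ ≃ₐ[ℚ] ℚ_[((primesEquiv v : Nat.Primes) : ℕ)] :=
    (adicCompletion.padicEquiv (R := 𝓞 ℚ) v).toAlgEquiv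
  let eA : Place.Completion (Sum.inr v : Place ℚ) ≃ₐ[ℚ] ℚ_[((primesEquiv v : Nat.Primes) : ℕ)] := eA0
  have hcont : Continuous eA0.symm := (adicCompletion.padicEquiv (R := 𝓞 ℚ) v).symm.continuous
  let w' : Valuation (v.adicCompletion ℚ) ℝ≥0 :=
    (NormedField.valuation (K := ℚ_[((primesEquiv v : Nat.Primes) : ℕ)])).comap
      (eA0 : v.adicCompletion ℚ →+* _)
  let w : Valuation (Place.Completion (Sum.inr v : Place ℚ)) ℝ≥0 := w'
  have hw : ∀ x, w' x = ‖eA0 x‖₊ := fun x => rfl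
  haveI : w.Compatible := compatible_of_norm_algEquiv _ v eA0 w' hw (norm_padicEquiv_le_one_iff v)
  haveI hIv : (W.baseChange (v.adicCompletion ℚ)).IsIntegral w'.integer :=
    isIntegral_baseChange_of_norm_algEquiv eA0 hw W
  haveI : (W.baseChange (Place.Completion (Sum.inr v : Place ℚ))).IsIntegral w.integer := hIv
  -- the compatibility of the two line data on crossed homomorphisms, from (RES_w) on classes
  have hcompat : ∀ (η₀ : contOneCocycles (restrictedTateRep W (Place.Completion (Sum.inr v : Place ℚ))
        ((primesEquiv v : Nat.Primes) : ℕ)).toTopRep)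
      (η : contOneCocycles ((restrictedTateRep W (Place.Completion (Sum.inr v : Place ℚ))
        ((primesEquiv v : Nat.Primes) : ℕ)).restrict
          (absGaloisRestrict (Place.Completion (Sum.inr v : Place ℚ)) L)).toTopRep),
      (∀ σ, η.1 σ = η₀.1 (absGaloisRestrict (Place.Completion (Sum.inr v : Place ℚ)) L σ)) →
      expStarCoordTower W (F₀ := Place.Completion (Sum.inr v : Place ℚ)) hL dw η =
        algebraMap (Place.Completion (Sum.inr v : Place ℚ)) L
          (expStarCoord W (valuation_place_lt_one _ v) d η₀) := by
    intro η₀ η hη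
    have hcl : oneCocycleClass (localTateRep W _ ((galRestrictPlace v).comp
          (absGaloisRestrict (Place.Completion (Sum.inr v : Place ℚ)) L))).toTopRep η =
        (tateLocalRep W _ (Sum.inr v)).cohomologyRes
          (absGaloisRestrict (Place.Completion (Sum.inr v : Place ℚ)) L) 1 (oneCocycleClass _ η₀) := by
      rw [cohomologyRes_oneCocycleClass]
      congr 1
      apply Subtype.ext
      apply ContinuousMap.ext
      intro σ
      exact hη σ
    rw [← expStarOmegaHom_comp_oneCocycleClass W _ v hL dw hinjw hexw, hcl, hres,
      expStarOmegaAt_eq_expStarCoord]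
  obtain ⟨e, he, h0, h1⟩ := hT₂ W (valuation_place_lt_one _ v) w hL ν d dw hinj hex hinjw hexw hcompat
  refine ⟨e, he, ?_, fun a => ?_⟩
  · -- (i): the base conjunct read in `ℚ_p` (rigidity: `ι = padicEquiv`)
    rw [ringHom_place_padic_ext _ v ι (eA : Place.Completion (Sum.inr v : Place ℚ) →+* _)]
    intro a
    have key := h0 (eA.symm a)
    have hLHS : (∃ y, expStarOmegaPadicAt (d.smul e he) hinj hex
          (eA : Place.Completion (Sum.inr v : Place ℚ) →+* _) y = a) ↔
        ∃ η : contOneCocycles (restrictedTateRep W (Place.Completion (Sum.inr v : Place ℚ)) _).toTopRep,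
          expStarCoord W (valuation_place_lt_one _ v) (d.smul e he) η = eA.symm a := by
      constructor
      · rintro ⟨y, hy⟩
        obtain ⟨η, rfl⟩ := oneCocycleClass_surjective _ y
        refine ⟨η, ?_⟩
        rw [expStarOmegaPadicAt_apply, expStarOmegaAt_eq_expStarCoord] at hy
        rw [← hy]
        exact (eA.symm_apply_apply _).symm
      · rintro ⟨η, hη⟩
        refine ⟨oneCocycleClass _ η, ?_⟩
        rw [expStarOmegaPadicAt_apply, expStarOmegaAt_eq_expStarCoord, hη]
        exact eA.apply_symm_apply a
    haveI := isIntegral_valuationInteger_of_isIntegral_padicInt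
      (W.baseChange ℚ_[((primesEquiv v : Nat.Primes) : ℕ)])
    have hlog : ∀ P : (W.baseChange (Place.Completion (Sum.inr v : Place ℚ))).toAffine.Point,
        eA (eA.symm a * padicLogPointFiniteExt w
            (W.baseChange (Place.Completion (Sum.inr v : Place ℚ))) ((primesEquiv v : Nat.Primes) : ℕ) P) =
          a * LocalLog.padicLog (W.baseChange ℚ_[((primesEquiv v : Nat.Primes) : ℕ)])
            (WeierstrassCurve.Affine.Point.map (eA : Place.Completion (Sum.inr v : Place ℚ) →ₐ[ℚ] _) P) := by
      intro P
      rw [map_mul, AlgEquiv.apply_symm_apply, padicLog_eq_padicLogPointFiniteExt]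
      congr 1
      exact (padicLogPointFiniteExt_map_algEquiv eA0 hw W P).symm
    have htr : ∀ x : Place.Completion (Sum.inr v : Place ℚ),
        Algebra.trace ℚ_[((primesEquiv v : Nat.Primes) : ℕ)] (Place.Completion (Sum.inr v : Place ℚ)) x = eA x :=
      fun x => trace_eq _ v eA0 hpv hcont x
    have hRHS : (∀ P : (W.baseChange (Place.Completion (Sum.inr v : Place ℚ))).toAffine.Point,
        ‖Algebra.trace ℚ_[((primesEquiv v : Nat.Primes) : ℕ)] (Place.Completion (Sum.inr v : Place ℚ))
            (eA.symm a * padicLogPointFiniteExt w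
              (W.baseChange (Place.Completion (Sum.inr v : Place ℚ))) ((primesEquiv v : Nat.Primes) : ℕ) P)‖ ≤ 1) ↔
        ∀ Q : (W.baseChange ℚ_[((primesEquiv v : Nat.Primes) : ℕ)]).toAffine.Point,
          ‖a * LocalLog.padicLog (W.baseChange ℚ_[((primesEquiv v : Nat.Primes) : ℕ)]) Q‖ ≤ 1 := by
      constructor
      · intro h Q
        obtain ⟨P, rfl⟩ := exists_map_algEquiv_eq eA0 W Q
        have hP := h P
        rwa [htr, hlog] at hP
      · intro h P
        rw [htr, hlog]
        exact h _
    exact hLHS.trans (key.trans hRHS)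
  · -- (ii): classes vs crossed homomorphisms on the tower representation
    refine Iff.trans ?_ (h1 a)
    constructor
    · rintro ⟨y, hy⟩
      obtain ⟨η, rfl⟩ := oneCocycleClass_surjective _ y
      exact ⟨η, by rw [← expStarOmegaHom_comp_oneCocycleClass W _ v hL _ hinjw hexw]; exact hy⟩
    · rintro ⟨η, hη⟩
      exact ⟨oneCocycleClass _ η, by rw [expStarOmegaHom_comp_oneCocycleClass W _ v hL _ hinjw hexw]; exact hη⟩

end Summit.BirchSwinnertonDyer.BirchSwinnertonDyer.Theorems.KimAtThreeDeepUpperExpStarTowerRange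

end
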